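import Summits.Ventures.HodgeRepro2.T6N41PlaceInertHyp
import Summits.Ventures.HodgeRepro2.T6N41PlaceMain

/-!
# T6N41PlaceInertMain — the Satake identity at the inert places, and the placement modulo its split half (Tier 6, M2; proof lane; owner t6-p4)

`satake_inert`: at every prime `𝔓` of `E` above an INERT place `v ∉ S`, the Satake parameters of
`BC(π_v) ⊗ χ_{V,v}` are `{η₁′(𝔓), η₂′(𝔓)}` — both `1` — from the two displays of `T6N41PlaceInertHyp` and the
inert datum: Harris II (2.2.5)(b) puts `π_v` in `JH(I(χ′/χ))` (`β′_v ≡ 1` by F1), Rogawski §11.4 gives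
`ρ̃ = i_G̃(χ̃)` with Satake parameters `((χ′/χ)(ϖ), (χ′/χ)(ϖ)⁻¹) = (−1, −1)` (F3: `(χ′/χ)(ϖ) = −1`, unitary), the
compat `BCχ_eq` and the twist rule give `BC(π_v) ⊗ χ_V = π((−1)(−1), (−1)⁻¹(−1)) = π(1, 1)` (F3: `χ_V(ϖ) = −1`),
`ps_inj` reads the parameters off `BCχ_ps`, and `η_eq_one` gives `η₁′(𝔓) = η₂′(𝔓) = 1` (TIER5 (P7), inert
places, and its FORCING READ BACK).

`satake_of_inert_split`: the full Satake identity `Pl.Satake` from `satake_inert` and the split half (residual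
of this layer — Mínguez Thm 1(2) + the split dictionary (A″κ), GR91 §3 / Rao 1993), given that every prime off
`S` is inert or split (`hdich`).  `N41_placement_inert`: the unramified identity `hunr` with the inert half
DISCHARGED — the displays LR §7, Bump (5.22), Harris II (2.2.5)(b), Rogawski §11.4 by name, the residual
`hsplit` (the Satake identity at the non-inert primes off `S`) and `hdich`.  `#print axioms` = {propext,
Classical.choice, Quot.sound}.

§8(d): uses an L-value-free non-vanishing device: NO.
-/

namespace Summit.Ventures.HodgeRepro2.T6
namespace N41Place

/-- **The Satake identity at the inert places.**  From Harris II (2.2.5)(b) (`hHa`) and Rogawski §11.4 (`hRo`)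
over the inert datum `In`: at every inert prime `𝔓` off `S`, `(α 𝔓, β 𝔓)` is `(η₁′(𝔓), η₂′(𝔓))` up to order. -/
theorem satake_inert {ι : Type*} {D : DoublingLDatum ι} {Pl : PlacementDatum D} (In : InertDatum Pl)
    (hHa : Hyp.HarrisII2007_Prop2_2_5_b In) (hRo : Hyp.Rogawski1990_Sec11_4_BC In) :
    ∀ 𝔓, In.inert 𝔓 → Pl.b 𝔓 ∉ D.S →
      (Pl.α 𝔓 = Pl.η₁ 𝔓 ∧ Pl.β 𝔓 = Pl.η₂ 𝔓) ∨ (Pl.α 𝔓 = Pl.η₂ 𝔓 ∧ Pl.β 𝔓 = Pl.η₁ 𝔓) := by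
  intro 𝔓 hi hS
  -- Harris: `π_v ∈ JH(I(χ′/χ))`
  have hmem : In.π (Pl.b 𝔓) ∈ In.JH 𝔓 (In.χHarris 𝔓) :=
    hHa 𝔓 hi hS (In.thetaLift_all _) (In.βTrivial_of 𝔓 hi hS)
  -- F3: `(χ′/χ)(ϖ) = −1`, a unitary value
  have hχ : In.χHarris 𝔓 = -1 := In.χHarris_eq 𝔓 hi hS
  have hunit : ‖((In.χHarris 𝔓 : ℂˣ) : ℂ)‖ = 1 := by
    rw [hχ]
    simp
  -- Rogawski: `ρ̃ = i_G̃(χ̃)` with Satake parameters `(−1, (−1)⁻¹)`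
  have hBC : In.BCrog 𝔓 (In.π (Pl.b 𝔓)) = Pl.ps 𝔓 (In.χHarris 𝔓) (In.χHarris 𝔓)⁻¹ :=
    hRo 𝔓 hi (In.χHarris 𝔓) hunit _ hmem
  -- the compat + the twist rule: `BC(π_v) ⊗ χ_V = π((−1)(−1), (−1)⁻¹(−1)) = π(1, 1)`
  have hBCχ : Pl.BCχ 𝔓 = Pl.ps 𝔓 1 1 := by
    rw [In.BCχ_eq 𝔓 hi hS, hBC, In.twist_ps, hχ, In.ξV_eq 𝔓 hi hS]
    simp
  -- read the parameters off `BCχ_ps`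
  have hαβ := In.ps_inj 𝔓 _ _ _ _ ((Pl.BCχ_ps 𝔓 hS).symm.trans hBCχ)
  obtain ⟨h₁, h₂⟩ := In.η_eq_one 𝔓 hi hS
  rw [h₁, h₂]
  rcases hαβ with ⟨ha, hb⟩ | ⟨ha, hb⟩ <;> exact Or.inl ⟨ha, hb⟩

/-- The full Satake identity from its inert half (`satake_inert`) and its split half (`hsplit`, the residual
of this layer), given that every prime off `S` is inert or split (`hdich`: a finite place of `F` unramified in
`E` is inert or split). -/
theorem satake_of_inert_split {ι : Type*} {D : DoublingLDatum ι} {Pl : PlacementDatum D}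
    (In : InertDatum Pl) (split : Pl.κ → Prop)
    (hdich : ∀ 𝔓, Pl.b 𝔓 ∉ D.S → In.inert 𝔓 ∨ split 𝔓)
    (hinert : ∀ 𝔓, In.inert 𝔓 → Pl.b 𝔓 ∉ D.S →
      (Pl.α 𝔓 = Pl.η₁ 𝔓 ∧ Pl.β 𝔓 = Pl.η₂ 𝔓) ∨ (Pl.α 𝔓 = Pl.η₂ 𝔓 ∧ Pl.β 𝔓 = Pl.η₁ 𝔓))
    (hsplit : ∀ 𝔓, split 𝔓 → Pl.b 𝔓 ∉ D.S →
      (Pl.α 𝔓 = Pl.η₁ 𝔓 ∧ Pl.β 𝔓 = Pl.η₂ 𝔓) ∨ (Pl.α 𝔓 = Pl.η₂ 𝔓 ∧ Pl.β 𝔓 = Pl.η₁ 𝔓)) :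
    Pl.Satake := by
  intro 𝔓 hS
  rcases hdich 𝔓 hS with hi | hs
  · exact hinert 𝔓 hi hS
  · exact hsplit 𝔓 hs hS

/-- **The unramified identity `hunr` with the inert half of (P7) discharged.**  Binders: the displays LR §7 /
§10, Bump (5.22), Harris II (2.2.5)(b), Rogawski §11.4 BY NAME; the dichotomy `hdich`; and the residual
`hsplit` — the Satake identity at the split primes off `S`. -/
theorem N41_placement_inert {ι : Type*} (D : DoublingLDatum ι) (Pl : PlacementDatum D) (In : InertDatum Pl)
    (split : Pl.κ → Prop)
    (hLR7 : Hyp.LapidRallis2005_Sec7_Unramified D Pl) (hB : Hyp.Bump1997_5_22 Pl)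
    (hHa : Hyp.HarrisII2007_Prop2_2_5_b In) (hRo : Hyp.Rogawski1990_Sec11_4_BC In)
    (hdich : ∀ 𝔓, Pl.b 𝔓 ∉ D.S → In.inert 𝔓 ∨ split 𝔓)
    -- [residual: AD (narrowed to the split primes); the Satake identity at a split `v ∉ S` — Mínguez Thm 1(2)
    -- + Harris II §2.2.9 + the split dictionary (A″κ) (GR91 §3.1–3.2 / Rao 1993), TIER5 §N4.1.9–10]
    (hsplit : ∀ 𝔓, split 𝔓 → Pl.b 𝔓 ∉ D.S →
      (Pl.α 𝔓 = Pl.η₁ 𝔓 ∧ Pl.β 𝔓 = Pl.η₂ 𝔓) ∨ (Pl.α 𝔓 = Pl.η₂ 𝔓 ∧ Pl.β 𝔓 = Pl.η₁ 𝔓)) :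
    ∀ v ∉ D.S, ∀ s : ℂ, D.Lv v s = D.g₁ v s * D.g₂ v s :=
  N41_placement_of_satake D Pl hLR7 hB
    (satake_of_inert_split In split hdich (satake_inert In hHa hRo) hsplit)

end N41Place
end Summit.Ventures.HodgeRepro2.T6
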